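import Summits.NavierStokesRegularity.NavierStokesRegularity.Theorems.HardyPointSinkHardyEnergyBoundTailTest

/-!
# `HardyPointSink.HardyEnergyBound` (stmt-NavierStokesRegularity-7979) is false as soon as ONE Kato solution
# from Clay data blows up with a tail — negative lemma modulo `TailedKatoBlowup` (lead c4 of line `registered`, 2026-08-17)

`--supports stmt-NavierStokesRegularity-7979`, lane `--negative-modulo TailedKatoBlowup`.

The crux C2 (`Theses.HardyPointSink.HardyEnergyBound`) asks, for EVERY `ν > 0`, Clay datum `u₀`, `T > 0` and Kato
solution `u` on `[0,T)`, at every centre `xs`, for a radius `r₀ > 0` and ONE constant `K` bounding the local Hardy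
energy `∫_{B(xs,r₀)} |u(t,x)|² / |x − x₀| dx` for all sinks `x₀ ∈ B(xs,r₀)` and all late times `T − r₀² < t < T`.

**The dyadic (ℓ¹-in-scales) reading of the Hardy energy (this file, §1).** With the dyadic shells
`S_k(x₀,δ) = B̄(x₀, δ/2ᵏ) \ B̄(x₀, δ/2ᵏ⁺¹)` and the SHELL-SCALED ENERGIES `A_k = (2ᵏ/δ) ∫_{S_k} |w|²` (the scaled
energy `r⁻¹∫|w|²` of Caffarelli–Kohn–Nirenberg / Seregin / Albritton–Barker at scale `r = δ/2ᵏ`, shell by shell),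

    Σ_k A_k ≤ ∫_{B̄(x₀,δ)} |w|²/|x − x₀| ≤ 2 Σ_k A_k

(`tsum_shellScaledEnergy_le_hardy`, `hardy_le_two_mul_tsum_shellScaledEnergy`). So C2 is the statement that the
shell-scaled energies of a Kato solution are SUMMABLE over scales, uniformly in the sink and in `t ↑ T` — an ℓ¹
strengthening of Type I in the scaled-energy sense (`sup_k A_k < ∞`, the ℓ^∞ condition; cf. `ScaledEnergyControlsTypeI`).

**The tightness fact (§2).** Hence C2 fails for ANY Kato solution from Clay data whose shell-scaled energies at some
point `xs` stay above a fixed `c > 0` across the first `N` dyadic scales, for every `N`, at times arbitrarily close to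
`T` — hypothesis `TailedKatoBlowup`. Proof: C2 gives `r₀, K` at `xs`; pick `k₀` with `δ/2^{k₀} < r₀` and `M` with
`K < M·c`; at a late time with `k₀ + M` saturated shells the shells `k₀ ≤ k < k₀ + M` lie in `B(xs,r₀)` and contribute
`≥ M·c > K` to the Hardy energy at the sink `x₀ = xs` (`HardyEnergyBound_false_of_TailedKatoBlowup`). Every blow-up
with a pointwise `C/|x − xs|` lower envelope on shells `ρ ≤ |x − xs| ≤ δ` down to vanishing `ρ` (the generic Type-I
profile tail, any backward (discretely) self-similar scenario with non-zero far-field constant, Type II with a tail)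
is of this kind with `c = (7/8)·|B₁|·C²` (`shellScaledEnergy_ge_of_pointwise_tail`, `tailedKatoBlowup_of_pointwise_tail`,
`HardyEnergyBound_false_of_pointwise_tail`; the logarithmic form of the same test is the tree's
`hardyEnergyBound_tail_lower_bound`). The contrapositive is recorded in positive form
(`shellScaledEnergy_dips_of_hardyEnergyBound`): under C2, for every Kato solution from Clay data, every centre and every
`c, δ > 0` there are `N` and `t₁ < T` such that at EVERY time `t ∈ [t₁,T)` some shell-scaled energy among the first `N`
scales is `< c` — C2 forces the dyadic scaled energies to dip below every Type-I rate near `T`.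

`TailedKatoBlowup` is NOT constructible in the tree: an inhabitant is in particular a Kato solution from a Clay datum
that is unbounded near `(T, xs)` (a bounded field has shell-scaled energies `≤ C r²`), i.e. a finite-time singularity
of Navier–Stokes from Schwartz-class data (¬ Clay (A); in-tree `not_navierStokesRegularity_of_not_hardyEnergyBound`);
hence the `--negative-modulo` lane and no verdict change on the item. What it pins down: the crux is exactly
"every first-time blow-up of a Kato solution from Clay data is tail-free in the ℓ¹(scales) sense".

References: L. Caffarelli, R. Kohn, L. Nirenberg, Comm. Pure Appl. Math. 35 (1982), §2 (scaled energy `A(r)`);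
G. Seregin, arXiv:math/0607537, Lemma 2.1; D. Albritton, T. Barker, arXiv:1811.00502, §1.
-/

noncomputable section

open Set MeasureTheory Filter Topology Metric Module
open scoped ENNReal NNReal

-- justification: the namespace is fixed by the crux protocol (`Theorems/<CruxDecl>/Negative/`).
set_option linter.dupNamespace false

namespace Summit.NavierStokesRegularity.NavierStokesRegularity.Theorems.HardyEnergyBound.Negative

open Literature.Analysis.FluidPDE

/-! ### §0 The hypothesis -/

/-- **Hypothesis `TailedKatoBlowup` (NOT constructible in the tree; filed `--negative-modulo`).** Some Kato
solution `u` on `[0,T)` (`T > 0`) of Navier–Stokes with viscosity `ν > 0` from a Clay datum `u₀` (smooth,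
divergence free, rapidly decaying — exactly the frame of the crux C2) is TAILED at some point `xs`: there are
`c > 0` and `δ > 0` such that for every number of scales `N` and every `t₁ ∈ [0,T)` some later time `t ∈ [t₁,T)`
has ALL its first `N` dyadic shell-scaled energies at `xs` saturated,
`(2ᵏ/δ) ∫_{B̄(xs,δ/2ᵏ) \ B̄(xs,δ/2ᵏ⁺¹)} |u(t,x)|² dx ≥ c` for `k < N`. A pointwise lower envelope
`C/|x − xs| ≤ |u(t,x)|` on `ρ(t) ≤ |x − xs| ≤ δ` with `ρ(t) → 0` along `t → T` is the special case
`c = (7/8)|B₁|C²` (`tailedKatoBlowup_of_pointwise_tail`). An inhabitant is a finite-time singularity of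
Navier–Stokes from Schwartz-class data. -/
def TailedKatoBlowup : Prop :=
  ∃ (ν : ℝ) (u₀ : EuclideanSpace ℝ (Fin 3) → EuclideanSpace ℝ (Fin 3)) (T : ℝ)
    (u : ℝ → EuclideanSpace ℝ (Fin 3) → EuclideanSpace ℝ (Fin 3)),
    0 < ν ∧ ContDiff ℝ (⊤ : ℕ∞) u₀ ∧ Literature.Analysis.FluidPDE.NSWave0.IsDivFree u₀ ∧
    Literature.Analysis.FluidPDE.HasRapidSpatialDecay u₀ ∧ 0 < T ∧
    Literature.Analysis.FluidPDE.IsKatoSolutionOn T ν u₀ u ∧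
    ∃ (xs : EuclideanSpace ℝ (Fin 3)) (c δ : ℝ), 0 < c ∧ 0 < δ ∧
      ∀ N : ℕ, ∀ t₁ ∈ Set.Ico 0 T, ∃ t ∈ Set.Ico t₁ T, ∀ k < N,
        ENNReal.ofReal c ≤ ENNReal.ofReal (2 ^ k / δ) *
          ∫⁻ x in Metric.closedBall xs (δ / 2 ^ k) \ Metric.closedBall xs (δ / 2 ^ (k + 1)), ‖u t x‖ₑ ^ 2

/-! ### §1 Dyadic shells and the ℓ¹ reading of the Hardy energy -/

/-- The dyadic radii `δ/2ᵏ` decrease in `k`. -/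
theorem dyadicRadius_antitone {δ : ℝ} (hδ : 0 ≤ δ) : Antitone fun k : ℕ => δ / 2 ^ k := by
  intro k l hkl
  exact div_le_div_of_nonneg_left hδ (by positivity) (pow_le_pow_right₀ one_le_two hkl)

/-- On the `k`-th dyadic shell the weight `|x − x₀|⁻¹` is at least `2ᵏ/δ`. -/
theorem ofReal_le_inv_enorm_of_mem_shell {x₀ x : EuclideanSpace ℝ (Fin 3)} {δ : ℝ} (hδ : 0 < δ) {k : ℕ}
    (hx : x ∈ closedBall x₀ (δ / 2 ^ k) \ closedBall x₀ (δ / 2 ^ (k + 1))) :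
    ENNReal.ofReal (2 ^ k / δ) ≤ ‖x - x₀‖ₑ⁻¹ := by
  have hk : 0 < δ / 2 ^ k := by positivity
  have hle : ‖x - x₀‖ ≤ δ / 2 ^ k := by
    have := hx.1
    rwa [mem_closedBall, dist_eq_norm] at this
  have h1 : ‖x - x₀‖ₑ ≤ ENNReal.ofReal (δ / 2 ^ k) := by
    rw [← ofReal_norm]
    exact ENNReal.ofReal_le_ofReal hle
  calc ENNReal.ofReal (2 ^ k / δ) = (ENNReal.ofReal (δ / 2 ^ k))⁻¹ := by
        rw [← ENNReal.ofReal_inv_of_pos hk, inv_div]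
    _ ≤ ‖x - x₀‖ₑ⁻¹ := ENNReal.inv_le_inv' h1

/-- On the `k`-th dyadic shell the weight `|x − x₀|⁻¹` is at most `2ᵏ⁺¹/δ`. -/
theorem inv_enorm_le_ofReal_of_mem_shell {x₀ x : EuclideanSpace ℝ (Fin 3)} {δ : ℝ} (hδ : 0 < δ) {k : ℕ}
    (hx : x ∈ closedBall x₀ (δ / 2 ^ k) \ closedBall x₀ (δ / 2 ^ (k + 1))) :
    ‖x - x₀‖ₑ⁻¹ ≤ ENNReal.ofReal (2 ^ (k + 1) / δ) := by
  have hk : 0 < δ / 2 ^ (k + 1) := by positivity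
  have hlt : δ / 2 ^ (k + 1) < ‖x - x₀‖ := by
    have := hx.2
    rw [mem_closedBall, dist_eq_norm, not_le] at this
    exact this
  have h1 : ENNReal.ofReal (δ / 2 ^ (k + 1)) ≤ ‖x - x₀‖ₑ := by
    rw [← ofReal_norm]
    exact ENNReal.ofReal_le_ofReal hlt.le
  calc ‖x - x₀‖ₑ⁻¹ ≤ (ENNReal.ofReal (δ / 2 ^ (k + 1)))⁻¹ := ENNReal.inv_le_inv' h1
    _ = ENNReal.ofReal (2 ^ (k + 1) / δ) := by rw [← ENNReal.ofReal_inv_of_pos hk, inv_div]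

/-- The dyadic shells about `x₀` are pairwise disjoint. -/
theorem pairwiseDisjoint_shells (x₀ : EuclideanSpace ℝ (Fin 3)) {δ : ℝ} (hδ : 0 ≤ δ) (s : Set ℕ) :
    s.PairwiseDisjoint fun k : ℕ => closedBall x₀ (δ / 2 ^ k) \ closedBall x₀ (δ / 2 ^ (k + 1)) := by
  intro k _ l _ hkl
  rcases lt_or_gt_of_ne hkl with h | h
  · refine disjoint_left.2 fun x hxk hxl => hxk.2 ?_
    exact closedBall_subset_closedBall (dyadicRadius_antitone hδ (Nat.succ_le_of_lt h)) hxl.1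
  · refine disjoint_left.2 fun x hxk hxl => hxl.2 ?_
    exact closedBall_subset_closedBall (dyadicRadius_antitone hδ (Nat.succ_le_of_lt h)) hxk.1

/-- **Shell-scaled energies are dominated by the Hardy energy, finitely many shells at a time.** For a finite set
`F` of scales, `Σ_{k ∈ F} (2ᵏ/δ) ∫_{S_k} |w|² ≤ ∫_{⋃_{k ∈ F} S_k} |w|²/|x − x₀|`. -/
theorem sum_shellScaledEnergy_le_hardy (w : EuclideanSpace ℝ (Fin 3) → EuclideanSpace ℝ (Fin 3))
    (x₀ : EuclideanSpace ℝ (Fin 3)) {δ : ℝ} (hδ : 0 < δ) (F : Finset ℕ) :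
    ∑ k ∈ F, ENNReal.ofReal (2 ^ k / δ) *
        ∫⁻ x in closedBall x₀ (δ / 2 ^ k) \ closedBall x₀ (δ / 2 ^ (k + 1)), ‖w x‖ₑ ^ 2 ≤
      ∫⁻ x in ⋃ k ∈ F, (closedBall x₀ (δ / 2 ^ k) \ closedBall x₀ (δ / 2 ^ (k + 1))),
        ‖w x‖ₑ ^ 2 / ‖x - x₀‖ₑ := by
  rw [lintegral_biUnion_finset (pairwiseDisjoint_shells x₀ hδ.le (F : Set ℕ))
    (fun k _ => measurableSet_closedBall.diff measurableSet_closedBall)]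
  refine Finset.sum_le_sum fun k _ => ?_
  rw [← lintegral_const_mul' _ _ ENNReal.ofReal_ne_top]
  refine setLIntegral_mono' (measurableSet_closedBall.diff measurableSet_closedBall) fun x hx => ?_
  rw [mul_comm, div_eq_mul_inv]
  exact mul_le_mul_right (ofReal_le_inv_enorm_of_mem_shell hδ hx) _

/-- **ℓ¹ reading, lower half.** `Σ_k (2ᵏ/δ) ∫_{S_k} |w|² ≤ ∫_{B̄(x₀,δ)} |w|²/|x − x₀|`. -/
theorem tsum_shellScaledEnergy_le_hardy (w : EuclideanSpace ℝ (Fin 3) → EuclideanSpace ℝ (Fin 3))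
    (x₀ : EuclideanSpace ℝ (Fin 3)) {δ : ℝ} (hδ : 0 < δ) :
    ∑' k : ℕ, ENNReal.ofReal (2 ^ k / δ) *
        ∫⁻ x in closedBall x₀ (δ / 2 ^ k) \ closedBall x₀ (δ / 2 ^ (k + 1)), ‖w x‖ₑ ^ 2 ≤
      ∫⁻ x in closedBall x₀ δ, ‖w x‖ₑ ^ 2 / ‖x - x₀‖ₑ := by
  rw [ENNReal.tsum_eq_iSup_nat]
  refine iSup_le fun N => (sum_shellScaledEnergy_le_hardy w x₀ hδ (Finset.range N)).trans ?_
  refine lintegral_mono_set (iUnion₂_subset fun k _ => sdiff_subset.trans ?_)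
  exact closedBall_subset_closedBall (div_le_self hδ.le (one_le_pow₀ one_le_two))

/-- Every point of the punctured closed ball `B̄(x₀,δ) \ {x₀}` lies in some dyadic shell. -/
theorem exists_mem_shell_of_mem_closedBall {x₀ x : EuclideanSpace ℝ (Fin 3)} {δ : ℝ} (hδ : 0 < δ)
    (hx : x ∈ closedBall x₀ δ) (hne : x ≠ x₀) :
    ∃ k : ℕ, x ∈ closedBall x₀ (δ / 2 ^ k) \ closedBall x₀ (δ / 2 ^ (k + 1)) := by
  have hd : 0 < dist x x₀ := dist_pos.2 hne
  have hdδ : dist x x₀ ≤ δ := mem_closedBall.1 hx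
  obtain ⟨n, hn1, hn2⟩ := exists_nat_pow_near_of_lt_one (div_pos hd hδ)
    ((div_le_one hδ).2 hdδ) (by norm_num : (0 : ℝ) < 1 / 2) (by norm_num : (1 : ℝ) / 2 < 1)
  refine ⟨n, ?_, ?_⟩
  · rw [mem_closedBall]
    have : dist x x₀ / δ ≤ 1 / 2 ^ n := by simpa [one_div, inv_pow] using hn2
    rw [div_le_iff₀ hδ] at this
    simpa [div_eq_mul_inv, mul_comm] using this
  · rw [mem_closedBall, not_le]
    have : 1 / 2 ^ (n + 1) < dist x x₀ / δ := by simpa [one_div, inv_pow] using hn1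
    rw [lt_div_iff₀ hδ] at this
    simpa [div_eq_mul_inv, mul_comm] using this

/-- **ℓ¹ reading, upper half.** `∫_{B̄(x₀,δ)} |w|²/|x − x₀| ≤ 2 Σ_k (2ᵏ/δ) ∫_{S_k} |w|²`. Together with
`tsum_shellScaledEnergy_le_hardy`: the local Hardy energy at a sink is, up to a factor `2`, the ℓ¹ norm over dyadic
scales of the shell-scaled energies. -/
theorem hardy_le_two_mul_tsum_shellScaledEnergy (w : EuclideanSpace ℝ (Fin 3) → EuclideanSpace ℝ (Fin 3))
    (x₀ : EuclideanSpace ℝ (Fin 3)) {δ : ℝ} (hδ : 0 < δ) :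
    ∫⁻ x in closedBall x₀ δ, ‖w x‖ₑ ^ 2 / ‖x - x₀‖ₑ ≤
      2 * ∑' k : ℕ, ENNReal.ofReal (2 ^ k / δ) *
        ∫⁻ x in closedBall x₀ (δ / 2 ^ k) \ closedBall x₀ (δ / 2 ^ (k + 1)), ‖w x‖ₑ ^ 2 := by
  set S : ℕ → Set (EuclideanSpace ℝ (Fin 3)) := fun k =>
    closedBall x₀ (δ / 2 ^ k) \ closedBall x₀ (δ / 2 ^ (k + 1)) with hS
  -- cover the closed ball by the centre and the shells
  have hcover : closedBall x₀ δ ⊆ {x₀} ∪ ⋃ k, S k := by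
    intro x hx
    by_cases hne : x = x₀
    · exact Or.inl hne
    · obtain ⟨k, hk⟩ := exists_mem_shell_of_mem_closedBall hδ hx hne
      exact Or.inr (mem_iUnion.2 ⟨k, hk⟩)
  have hcentre : ∫⁻ x in ({x₀} : Set (EuclideanSpace ℝ (Fin 3))), ‖w x‖ₑ ^ 2 / ‖x - x₀‖ₑ = 0 :=
    setLIntegral_measure_zero _ _ (measure_singleton x₀)
  calc ∫⁻ x in closedBall x₀ δ, ‖w x‖ₑ ^ 2 / ‖x - x₀‖ₑ
      ≤ ∫⁻ x in {x₀} ∪ ⋃ k, S k, ‖w x‖ₑ ^ 2 / ‖x - x₀‖ₑ := lintegral_mono_set hcover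
    _ ≤ (∫⁻ x in ({x₀} : Set (EuclideanSpace ℝ (Fin 3))), ‖w x‖ₑ ^ 2 / ‖x - x₀‖ₑ)
          + ∫⁻ x in ⋃ k, S k, ‖w x‖ₑ ^ 2 / ‖x - x₀‖ₑ := lintegral_union_le _ _ _
    _ = ∫⁻ x in ⋃ k, S k, ‖w x‖ₑ ^ 2 / ‖x - x₀‖ₑ := by rw [hcentre, zero_add]
    _ ≤ ∑' k, ∫⁻ x in S k, ‖w x‖ₑ ^ 2 / ‖x - x₀‖ₑ := lintegral_iUnion_le _ _
    _ ≤ ∑' k, 2 * (ENNReal.ofReal (2 ^ k / δ) * ∫⁻ x in S k, ‖w x‖ₑ ^ 2) := by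
        refine ENNReal.tsum_le_tsum fun k => ?_
        rw [← mul_assoc, ← lintegral_const_mul' _ _ (by finiteness)]
        refine setLIntegral_mono' (measurableSet_closedBall.diff measurableSet_closedBall) fun x hx => ?_
        have h2 : (2 : ℝ≥0∞) * ENNReal.ofReal (2 ^ k / δ) = ENNReal.ofReal (2 ^ (k + 1) / δ) := by
          rw [← ENNReal.ofReal_ofNat 2, ← ENNReal.ofReal_mul (by norm_num), pow_succ]
          ring_nf
        rw [h2, mul_comm, div_eq_mul_inv]
        exact mul_le_mul_right (inv_enorm_le_ofReal_of_mem_shell hδ hx) _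
    _ = 2 * ∑' k, ENNReal.ofReal (2 ^ k / δ) * ∫⁻ x in S k, ‖w x‖ₑ ^ 2 := ENNReal.tsum_mul_left

/-! ### §2 The negative lemma -/

/-- **`HardyEnergyBound` is false modulo `TailedKatoBlowup`.** If some Kato solution from Clay data keeps its
first `N` shell-scaled energies at a point `xs` above a fixed `c > 0`, for every `N`, at times arbitrarily close
to `T`, then the local Hardy bound of C2 fails at `xs` (sink `x₀ = xs`): the shells `k₀ ≤ k < k₀ + M` with
`δ/2^{k₀} < r₀` lie in `B(xs,r₀)` and carry Hardy energy `≥ M·c`, unbounded in `M`. -/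
theorem HardyEnergyBound_false_of_TailedKatoBlowup :
    TailedKatoBlowup → ¬ Summit.NavierStokesRegularity.NavierStokesRegularity.Theses.HardyPointSink.HardyEnergyBound := by
  rintro ⟨ν, u₀, T, u, hν, hsm, hdiv, hdec, hT, hu, xs, c, δ, hc, hδ, htail⟩ hC2
  obtain ⟨r₀, hr₀, K, hK⟩ := hC2 ν hν u₀ hsm hdiv hdec T u hT hu xs
  -- a dyadic scale strictly inside `B(xs, r₀)`
  obtain ⟨k₀, hk₀⟩ : ∃ k₀ : ℕ, δ / 2 ^ k₀ < r₀ := by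
    obtain ⟨k₀, hk₀⟩ := pow_unbounded_of_one_lt (δ / r₀) (by norm_num : (1 : ℝ) < 2)
    exact ⟨k₀, by rwa [div_lt_comm₀ (by positivity) hr₀]⟩
  -- the number of saturated shells needed to beat `K`
  obtain ⟨M, hM⟩ : ∃ M : ℕ, (K : ℝ) < M * c := by
    obtain ⟨M, hM⟩ := exists_nat_gt ((K : ℝ) / c)
    exact ⟨M, by rwa [div_lt_iff₀ hc] at hM⟩
  -- a late time with `k₀ + M` saturated shells
  have ht₁ : max 0 (T - r₀ ^ 2 / 2) ∈ Ico 0 T :=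
    ⟨le_max_left _ _, max_lt hT (by nlinarith [sq_nonneg r₀])⟩
  obtain ⟨t, ht, hsat⟩ := htail (k₀ + M) _ ht₁
  have ht0 : t ∈ Ico 0 T := ⟨(le_max_left _ _).trans ht.1, ht.2⟩
  have htr : T - r₀ ^ 2 < t := by
    have h1 : T - r₀ ^ 2 / 2 ≤ t := (le_max_right _ _).trans ht.1
    nlinarith [sq_nonneg r₀, hr₀]
  -- C2 at the sink `x₀ = xs`
  have hHardy := hK xs (mem_ball_self hr₀) t ht0 htr
  -- the shells `k₀ ≤ k < k₀ + M` lie in the ball and carry `≥ M·c`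
  set F : Finset ℕ := Finset.Ico k₀ (k₀ + M) with hF
  have hsub : (⋃ k ∈ F, (closedBall xs (δ / 2 ^ k) \ closedBall xs (δ / 2 ^ (k + 1)))) ⊆ ball xs r₀ := by
    refine iUnion₂_subset fun k hk => sdiff_subset.trans ?_
    have hk' : k₀ ≤ k := (Finset.mem_Ico.1 hk).1
    exact (closedBall_subset_closedBall (dyadicRadius_antitone hδ.le hk')).trans
      (closedBall_subset_ball hk₀)
  have hlow : (M : ℝ≥0∞) * ENNReal.ofReal c ≤ ∫⁻ x in ball xs r₀, ‖u t x‖ₑ ^ 2 / ‖x - xs‖ₑ := by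
    calc (M : ℝ≥0∞) * ENNReal.ofReal c = ∑ k ∈ F, ENNReal.ofReal c := by
          rw [Finset.sum_const, hF, Nat.card_Ico, Nat.add_sub_cancel_left, nsmul_eq_mul]
      _ ≤ ∑ k ∈ F, ENNReal.ofReal (2 ^ k / δ) *
            ∫⁻ x in closedBall xs (δ / 2 ^ k) \ closedBall xs (δ / 2 ^ (k + 1)), ‖u t x‖ₑ ^ 2 :=
          Finset.sum_le_sum fun k hk => hsat k (Finset.mem_Ico.1 hk).2
      _ ≤ _ := sum_shellScaledEnergy_le_hardy (u t) xs hδ F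
      _ ≤ ∫⁻ x in ball xs r₀, ‖u t x‖ₑ ^ 2 / ‖x - xs‖ₑ := lintegral_mono_set hsub
  -- contradiction: `M·c ≤ K < M·c`
  have hfin : (M : ℝ≥0∞) * ENNReal.ofReal c ≤ (K : ℝ≥0∞) := hlow.trans hHardy
  have hreal : (M : ℝ) * c ≤ K := by
    have h1 : (M : ℝ≥0∞) * ENNReal.ofReal c = ENNReal.ofReal (M * c) := by
      rw [ENNReal.ofReal_mul (Nat.cast_nonneg M), ENNReal.ofReal_natCast]
    rw [h1, ← ENNReal.ofReal_coe_nnreal] at hfin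
    exact (ENNReal.ofReal_le_ofReal_iff K.coe_nonneg).1 hfin
  exact absurd hM (not_lt.2 hreal)

/-- **Positive form of the negative lemma: C2 forces the shell-scaled energies to dip.** Under `HardyEnergyBound`,
for every Kato solution from Clay data, every centre `xs` and all `c, δ > 0`, there are `N` and `t₁ ∈ [0,T)` such
that at EVERY `t ∈ [t₁,T)` one of the first `N` shell-scaled energies at `xs` is `< c`. -/
theorem shellScaledEnergy_dips_of_hardyEnergyBound
    (hC2 : Summit.NavierStokesRegularity.NavierStokesRegularity.Theses.HardyPointSink.HardyEnergyBound)
    {ν : ℝ} (hν : 0 < ν) {u₀ : EuclideanSpace ℝ (Fin 3) → EuclideanSpace ℝ (Fin 3)}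
    (hsm : ContDiff ℝ (⊤ : ℕ∞) u₀) (hdiv : NSWave0.IsDivFree u₀) (hdec : HasRapidSpatialDecay u₀)
    {T : ℝ} {u : ℝ → EuclideanSpace ℝ (Fin 3) → EuclideanSpace ℝ (Fin 3)} (hT : 0 < T)
    (hu : IsKatoSolutionOn T ν u₀ u) (xs : EuclideanSpace ℝ (Fin 3)) {c δ : ℝ} (hc : 0 < c) (hδ : 0 < δ) :
    ∃ N : ℕ, ∃ t₁ ∈ Set.Ico 0 T, ∀ t ∈ Set.Ico t₁ T, ∃ k < N,
      ENNReal.ofReal (2 ^ k / δ) *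
          ∫⁻ x in closedBall xs (δ / 2 ^ k) \ closedBall xs (δ / 2 ^ (k + 1)), ‖u t x‖ₑ ^ 2 <
        ENNReal.ofReal c := by
  by_contra h
  push Not at h
  exact HardyEnergyBound_false_of_TailedKatoBlowup
    ⟨ν, u₀, T, u, hν, hsm, hdiv, hdec, hT, hu, xs, c, δ, hc, hδ, h⟩ hC2

/-! ### §3 Pointwise tails are shell-saturated -/

/-- **A pointwise `C/|x − xs|` envelope saturates the shells it covers.** If `C/|x − xs| ≤ |w(x)|` for
`ρ ≤ |x − xs| ≤ δ` and the `k`-th dyadic shell of `B̄(xs,δ)` lies in that range (`ρ ≤ δ/2ᵏ⁺¹`), then its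
shell-scaled energy is at least `(7/8)|B₁|C²` (`|S_k| = (7/8)|B₁|(δ/2ᵏ)³`, `|w|² ≥ C²(2ᵏ/δ)²` on `S_k`). -/
theorem shellScaledEnergy_ge_of_pointwise_tail (w : EuclideanSpace ℝ (Fin 3) → EuclideanSpace ℝ (Fin 3))
    (xs : EuclideanSpace ℝ (Fin 3)) {C ρ δ : ℝ} (hC : 0 ≤ C) (hδ : 0 < δ)
    (htail : ∀ x, ρ ≤ ‖x - xs‖ → ‖x - xs‖ ≤ δ → C / ‖x - xs‖ ≤ ‖w x‖) {k : ℕ}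
    (hk : ρ ≤ δ / 2 ^ (k + 1)) :
    ENNReal.ofReal (7 / 8 * (volume : Measure (EuclideanSpace ℝ (Fin 3))).real (ball 0 1) * C ^ 2) ≤
      ENNReal.ofReal (2 ^ k / δ) *
        ∫⁻ x in closedBall xs (δ / 2 ^ k) \ closedBall xs (δ / 2 ^ (k + 1)), ‖w x‖ₑ ^ 2 := by
  set a : ℝ := δ / 2 ^ k with ha
  have ha0 : 0 < a := by positivity
  have ha2 : δ / 2 ^ (k + 1) = a / 2 := by rw [ha, pow_succ]; ring
  have haδ : a ≤ δ := div_le_self hδ.le (one_le_pow₀ one_le_two)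
  set S : Set (EuclideanSpace ℝ (Fin 3)) := closedBall xs (δ / 2 ^ k) \ closedBall xs (δ / 2 ^ (k + 1))
    with hS
  have hSm : MeasurableSet S := measurableSet_closedBall.diff measurableSet_closedBall
  -- pointwise lower bound on the shell
  have hpt : ∀ x ∈ S, ENNReal.ofReal (C ^ 2 / a ^ 2) ≤ ‖w x‖ₑ ^ 2 := by
    intro x hx
    have hxle : ‖x - xs‖ ≤ a := by
      have := hx.1; rwa [mem_closedBall, dist_eq_norm] at this
    have hxgt : a / 2 < ‖x - xs‖ := by
      have := hx.2; rwa [mem_closedBall, dist_eq_norm, not_le, ha2] at this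
    have hxpos : 0 < ‖x - xs‖ := (half_pos ha0).trans hxgt
    have hρx : ρ ≤ ‖x - xs‖ := (hk.trans_eq ha2).trans hxgt.le
    have h1 : C / a ≤ ‖w x‖ :=
      (div_le_div_of_nonneg_left hC hxpos hxle).trans (htail x hρx (hxle.trans haδ))
    have h2 : C ^ 2 / a ^ 2 ≤ ‖w x‖ ^ 2 := by
      rw [← div_pow]; exact pow_le_pow_left₀ (div_nonneg hC ha0.le) h1 2
    calc ENNReal.ofReal (C ^ 2 / a ^ 2) ≤ ENNReal.ofReal (‖w x‖ ^ 2) := ENNReal.ofReal_le_ofReal h2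
      _ = ‖w x‖ₑ ^ 2 := by rw [← ofReal_norm, ENNReal.ofReal_pow (norm_nonneg _)]
  -- volume of the shell from below
  have hvol : ENNReal.ofReal (7 / 8 * a ^ 3) * volume (ball (0 : EuclideanSpace ℝ (Fin 3)) 1) ≤ volume S := by
    have hout : volume (closedBall xs (δ / 2 ^ k)) =
        ENNReal.ofReal (a ^ 3) * volume (ball (0 : EuclideanSpace ℝ (Fin 3)) 1) := by
      rw [Measure.addHaar_closedBall _ _ ha0.le, finrank_euclideanSpace_fin]
    have hin : volume (closedBall xs (δ / 2 ^ (k + 1))) =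
        ENNReal.ofReal ((a / 2) ^ 3) * volume (ball (0 : EuclideanSpace ℝ (Fin 3)) 1) := by
      rw [ha2, Measure.addHaar_closedBall _ _ (half_pos ha0).le, finrank_euclideanSpace_fin]
    calc ENNReal.ofReal (7 / 8 * a ^ 3) * volume (ball (0 : EuclideanSpace ℝ (Fin 3)) 1)
        = (ENNReal.ofReal (a ^ 3) - ENNReal.ofReal ((a / 2) ^ 3)) *
            volume (ball (0 : EuclideanSpace ℝ (Fin 3)) 1) := by
          rw [← ENNReal.ofReal_sub _ (by positivity)]
          congr 1; congr 1; ring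
      _ = volume (closedBall xs (δ / 2 ^ k)) - volume (closedBall xs (δ / 2 ^ (k + 1))) := by
          rw [hout, hin, ENNReal.sub_mul fun _ _ => measure_ball_lt_top.ne]
      _ ≤ volume S := le_measure_sdiff
  -- assemble
  have hV : ENNReal.ofReal ((volume : Measure (EuclideanSpace ℝ (Fin 3))).real (ball 0 1)) =
      volume (ball (0 : EuclideanSpace ℝ (Fin 3)) 1) := ENNReal.ofReal_toReal measure_ball_lt_top.ne
  calc ENNReal.ofReal (7 / 8 * (volume : Measure (EuclideanSpace ℝ (Fin 3))).real (ball 0 1) * C ^ 2)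
      = ENNReal.ofReal (2 ^ k / δ) * (ENNReal.ofReal (C ^ 2 / a ^ 2) *
          (ENNReal.ofReal (7 / 8 * a ^ 3) * volume (ball (0 : EuclideanSpace ℝ (Fin 3)) 1))) := by
        rw [← hV, ← mul_assoc, ← mul_assoc, ← ENNReal.ofReal_mul (by positivity),
          ← ENNReal.ofReal_mul (by positivity), ← ENNReal.ofReal_mul (by positivity)]
        congr 1
        have h2k : (2 : ℝ) ^ k / δ = a⁻¹ := by rw [ha, inv_div]
        rw [h2k]
        field_simp
    _ ≤ ENNReal.ofReal (2 ^ k / δ) * (ENNReal.ofReal (C ^ 2 / a ^ 2) * volume S) := by gcongr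
    _ = ENNReal.ofReal (2 ^ k / δ) * ∫⁻ _ in S, ENNReal.ofReal (C ^ 2 / a ^ 2) := by
        rw [setLIntegral_const]
    _ ≤ ENNReal.ofReal (2 ^ k / δ) * ∫⁻ x in S, ‖w x‖ₑ ^ 2 :=
        mul_le_mul_right (setLIntegral_mono' hSm hpt) _

/-- **Pointwise tails persisting to vanishing scales give `TailedKatoBlowup`.** If a Kato solution from Clay data
has, at some `xs`, constants `C, δ > 0` such that for every `ρ > 0` and every `t₁ ∈ [0,T)` some `t ∈ [t₁,T)` has the
lower envelope `C/|x − xs| ≤ |u(t,x)|` on `ρ ≤ |x − xs| ≤ δ`, then `TailedKatoBlowup` holds (with `c = (7/8)|B₁|C²`). -/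
theorem tailedKatoBlowup_of_pointwise_tail
    (h : ∃ (ν : ℝ) (u₀ : EuclideanSpace ℝ (Fin 3) → EuclideanSpace ℝ (Fin 3)) (T : ℝ)
      (u : ℝ → EuclideanSpace ℝ (Fin 3) → EuclideanSpace ℝ (Fin 3)),
      0 < ν ∧ ContDiff ℝ (⊤ : ℕ∞) u₀ ∧ NSWave0.IsDivFree u₀ ∧ HasRapidSpatialDecay u₀ ∧ 0 < T ∧
      IsKatoSolutionOn T ν u₀ u ∧
      ∃ (xs : EuclideanSpace ℝ (Fin 3)) (C δ : ℝ), 0 < C ∧ 0 < δ ∧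
        ∀ ρ : ℝ, 0 < ρ → ∀ t₁ ∈ Set.Ico 0 T, ∃ t ∈ Set.Ico t₁ T,
          ∀ x, ρ ≤ ‖x - xs‖ → ‖x - xs‖ ≤ δ → C / ‖x - xs‖ ≤ ‖u t x‖) :
    TailedKatoBlowup := by
  obtain ⟨ν, u₀, T, u, hν, hsm, hdiv, hdec, hT, hu, xs, C, δ, hC, hδ, htail⟩ := h
  have hV : 0 < (volume : Measure (EuclideanSpace ℝ (Fin 3))).real (ball 0 1) :=
    ENNReal.toReal_pos (measure_ball_pos volume _ one_pos).ne' measure_ball_lt_top.ne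
  refine ⟨ν, u₀, T, u, hν, hsm, hdiv, hdec, hT, hu, xs,
    7 / 8 * (volume : Measure (EuclideanSpace ℝ (Fin 3))).real (ball 0 1) * C ^ 2, δ,
    by positivity, hδ, fun N t₁ ht₁ => ?_⟩
  obtain ⟨t, ht, henv⟩ := htail (δ / 2 ^ N) (by positivity) t₁ ht₁
  refine ⟨t, ht, fun k hk => ?_⟩
  refine shellScaledEnergy_ge_of_pointwise_tail (u t) xs hC.le hδ henv ?_
  exact dyadicRadius_antitone hδ.le (Nat.succ_le_of_lt hk)

/-- **`HardyEnergyBound` is false as soon as one Kato solution from Clay data blows up with a pointwise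
`C/|x − xs|` tail down to vanishing scales** (the literature's tailed Type-I / Type-II scenarios; corollary of
`HardyEnergyBound_false_of_TailedKatoBlowup` and `tailedKatoBlowup_of_pointwise_tail`). -/
theorem HardyEnergyBound_false_of_pointwise_tail
    (h : ∃ (ν : ℝ) (u₀ : EuclideanSpace ℝ (Fin 3) → EuclideanSpace ℝ (Fin 3)) (T : ℝ)
      (u : ℝ → EuclideanSpace ℝ (Fin 3) → EuclideanSpace ℝ (Fin 3)),
      0 < ν ∧ ContDiff ℝ (⊤ : ℕ∞) u₀ ∧ NSWave0.IsDivFree u₀ ∧ HasRapidSpatialDecay u₀ ∧ 0 < T ∧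
      IsKatoSolutionOn T ν u₀ u ∧
      ∃ (xs : EuclideanSpace ℝ (Fin 3)) (C δ : ℝ), 0 < C ∧ 0 < δ ∧
        ∀ ρ : ℝ, 0 < ρ → ∀ t₁ ∈ Set.Ico 0 T, ∃ t ∈ Set.Ico t₁ T,
          ∀ x, ρ ≤ ‖x - xs‖ → ‖x - xs‖ ≤ δ → C / ‖x - xs‖ ≤ ‖u t x‖) :
    ¬ Summit.NavierStokesRegularity.NavierStokesRegularity.Theses.HardyPointSink.HardyEnergyBound :=
  HardyEnergyBound_false_of_TailedKatoBlowup (tailedKatoBlowup_of_pointwise_tail h)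

end Summit.NavierStokesRegularity.NavierStokesRegularity.Theorems.HardyEnergyBound.Negative

end
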